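import Literature.Computability.Complexity.BitFormats
import Literature.Computability.Complexity.BoolEncodings
import HarnessLib

/-!
# Bit formats: the written strings, combinator by combinator

Trunk T-CPLX-CORE, generic; companion of `BitFormats.lean`. The string `toList (Φ.write a)` of
each format combinator in list form — `toList_prod_write` (concatenation), `toList_pi_write`
(the blocks, flattened), `toList_option_write` (presence bit, then the datum), `toList_ofEquiv_write`,
and the base cases `toList_ofLayout_vector`, `toList_ofLayout_zvec`, `bitsToNat_toList_finPow`
(the written binary number has the value written), `read_natB_eq` (the value read by `natB`) —
so that a programme emitting a message field by field provably emits `toList (format.write msg)`.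
Written for the App. D machine programmes (`Literature.Barriers.PneNP.AkaviaEtAl2006_complMemAM`).
All proved, [folklore].

## References

* [AroraBarakCC2009] S. Arora, B. Barak, *Computational Complexity: A Modern Approach*, CUP 2009,
  §1.2 (representing objects as strings).
-/

namespace Literature.Computability.Complexity

open Finset

namespace BitFormat

variable {α β : Type*} {N N₁ N₂ : ℕ}

/-- A joined string is the concatenation. [folklore] -/
@[simp] theorem toList_join (a : Fin N₁ → Bool) (b : Fin N₂ → Bool) : toList (join (a, b)) = toList a ++ toList b :=
  List.ofFn_fin_append a b

/-- **A written pair is the concatenation of the written components.** [folklore] -/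
@[simp] theorem toList_prod_write (Φ₁ : BitFormat α N₁) (Φ₂ : BitFormat β N₂) (p : α × β) :
    toList ((prod Φ₁ Φ₂).write p) = toList (Φ₁.write p.1) ++ toList (Φ₂.write p.2) :=
  toList_join _ _

/-- **A written tuple is the flattening of the written blocks.** [folklore] -/
theorem toList_pi_write (Φ : BitFormat α N) (k : ℕ) (g : Fin k → α) :
    toList ((pi Φ k).write g) = (List.ofFn fun i => toList (Φ.write (g i))).flatten := by
  unfold toList pi blocks
  rw [List.ofFn_mul]
  refine congrArg List.flatten (congrArg List.ofFn (funext fun i => congrArg List.ofFn (funext fun j => ?_)))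
  have h : finProdFinEquiv.symm (⟨(i : ℕ) * N + j, by
      calc (i : ℕ) * N + j < (i + 1) * N := by have := j.isLt; nlinarith
        _ ≤ k * N := Nat.mul_le_mul_right _ i.isLt⟩ : Fin (k * N)) = (i, j) := by
    rw [Equiv.symm_apply_eq]; apply Fin.ext; simp [finProdFinEquiv]; ring
  simp only [h]

/-- **A written option is the presence bit followed by the written datum (or default).** [folklore] -/
@[simp] theorem toList_option_write (Φ : BitFormat α N) (d : α) (o : Option α) :
    toList ((option Φ d).write o) = o.isSome :: toList (Φ.write (o.getD d)) := by
  unfold option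
  rw [toList_join]
  rfl

/-- Transported formats write through the bijection. [folklore] -/
@[simp] theorem toList_ofEquiv_write (e : β ≃ α) (Φ : BitFormat α N) (b : β) : (ofEquiv e Φ).write b = Φ.write (e b) := rfl

/-- A bit vector is written as itself. [folklore] -/
@[simp] theorem toList_ofLayout_vector (k : ℕ) (v : List.Vector Bool k) : toList ((ofLayout (BitLayout.vector k)).write v) = v.toList := by
  unfold toList ofLayout BitLayout.vector
  rcases v with ⟨l, rfl⟩
  exact List.ofFn_get l

/-- A vector over `𝔽₂` is written bit by bit. [folklore] -/
@[simp] theorem toList_ofLayout_zvec (k : ℕ) (v : Fin k → ZMod 2) :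
    toList ((ofLayout (BitLayout.zvec k)).write v) = List.ofFn fun i => BitLayout.zmod2Equiv (v i) := rfl

/-- The value of a little-endian bit list. [folklore] -/
theorem bitsToNat_ofFn : ∀ {k : ℕ} (v : Fin k → Bool), bitsToNat (List.ofFn v) = ∑ i : Fin k, (v i).toNat * 2 ^ (i : ℕ)
  | 0, v => by simp
  | k + 1, v => by
    rw [List.ofFn_succ, bitsToNat_cons, bitsToNat_ofFn, Fin.sum_univ_succ]
    simp only [Fin.val_zero, pow_zero, mul_one, Fin.val_succ, pow_succ]
    rw [Finset.mul_sum]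
    congr 1; refine Finset.sum_congr rfl fun i _ => ?_; ring

/-- **The written binary number has the value written.** [folklore] -/
theorem bitsToNat_toList_finPow (k : ℕ) (t : Fin (2 ^ k)) : bitsToNat (toList ((ofLayout (BitLayout.finPow k)).write t)) = t := by
  unfold toList ofLayout
  rw [bitsToNat_ofFn, ← BitLayout.finPow_symm_val, Equiv.symm_apply_apply]

/-- **The value read by `natB`** from `b` bits. [folklore] -/
theorem read_natB_eq (b : ℕ) (v : Fin b → Bool) : (natB b).read v = ∑ i : Fin b, (v i).toNat * 2 ^ (i : ℕ) := by
  unfold natB; exact BitLayout.finPow_symm_val b v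

/-- The value read by `natB` from a list of bits is `bitsToNat` of its first `b` bits. [folklore] -/
theorem read_natB_ofList (b : ℕ) (l : List Bool) (h : b ≤ l.length) : (natB b).read (ofList b l) = bitsToNat (l.take b) := by
  rw [read_natB_eq]
  have : l.take b = List.ofFn (ofList b l) := by
    apply List.ext_getElem
    · simp; omega
    · intro i h1 h2
      simp only [List.length_take] at h1
      simp [ofList, List.getD_eq_getElem?_getD, List.getElem?_eq_getElem (by omega : i < l.length)]
  rw [this, bitsToNat_ofFn]

end BitFormat

end Literature.Computability.Complexity
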